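import Mathlib
import Summits.AtomisticToContinuum.HydrodynamicLimit.Theorems.ImplosionDichotomyDenseExcursionCavityResDescent
import Summits.AtomisticToContinuum.HydrodynamicLimit.Theorems.ImplosionDichotomyDenseExcursionCavityResVolterraUniform

/-!
# The smooth branch for `Re ν ≤ −1` with UNIFORM radius, a priori bounds and uniqueness (vector-valued regular row)
# (crux `DenseExcursion`, line `sonic-cavity-renewal`, brick for stub `stub_cavityResolventCk`, theorem T7(i))

Helper file (`--supports stmt-AtomisticToContinuum-12586`, line lead a2, stub-worker E2 for `stub_cavityResolventCk`).
Quantitative form of `res_fuchs_branch` (registered helper `res_fuchs_uniform`). For a complex Banach space `E` and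
BOUNDS `A₁, A, B, D` there are `0 < δ ≤ 1` and `K ≥ 0`, depending ONLY on the bounds, such that for every exponent `ν`
with `Re ν ≤ −1` and all smooth coefficient fields of the first-kind singular system

  `R·u′ = a₁₁ u + a₁₂(c) + b₁`,   `c′ = a₂₁(u) + a₂₂(c) + b₂`,   `a₁₁(0) = ν`,

with `‖a₁₁′‖ ≤ A₁`, `‖a₁₂‖ ≤ A`, `‖a₂₁‖ ≤ B`, `‖a₂₂‖ ≤ D` on `[−1, 1]`, and all smooth sources:
(EXISTENCE) for every `c₀` a `C^∞` solution on `(−δ, δ)` with `c(0) = c₀`;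
(A PRIORI BOUND) every `C¹` solution on some `(−δ′, δ′)`, `δ′ ≤ δ`, obeys `‖u‖, ‖c‖ ≤ K(‖c(0)‖ + N)` on `[−R₁, R₁]`
(`R₁ < δ′`) whenever `‖b₁‖, ‖b₂‖ ≤ N` there. By linearity this contains UNIQUENESS of `C¹` solutions with given `c(0)`
(hence evenness under even/odd data, identification of different constructions) and, by the difference trick,
Lipschitz continuity of the solution in parameters entering the coefficients boundedly (continuity in `Λ`).
The scalar form `fuchs_branch_uniform` (registered; `E = ℂ`, scalar coefficients) also records EVENNESS of every `C¹`
solution under even `a₁₁, a₁₂, b₁` and odd `a₂₁, a₂₂, b₂` (the reflected solution solves the same system: uniqueness) —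
the form consumed by the centre branch in the signed radius. Mechanism of the a priori bound: a `C¹` solution satisfies the Volterra integral equations of `res_volterra_uniform`
(`c`-row: fundamental theorem of calculus; `u`-row: `w = u/μ − E_a h` solves the exact Euler row `R w′ = ν w` with
`w(0) = 0`, and `‖w‖²` is non-increasing in `|R|` because `R (‖w‖²)′ = 2 Re ν ‖w‖² ≤ 0` — no complex powers needed).
Sources: folklore (Coddington–Levinson 1955 Ch. 4 §2).
-/

noncomputable section

open Set Filter MeasureTheory intervalIntegral
open scoped Topology ContDiff RealInnerProductSpace Interval

namespace Summit.AtomisticToContinuum.HydrodynamicLimit.Theorems.SonicCavityRenewal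

/-! ## The exact Euler row `R w′ = ν w`, `Re ν < 0`: only the zero solution is `C¹` at `R = 0` -/

/-- The real inner product `⟪w, ν w⟫ = Re ν · ‖w‖²` on `ℂ ≅ ℝ²`. [folklore] -/
theorem real_inner_mul_self_left (ν w : ℂ) : ⟪w, ν * w⟫ = ν.re * ‖w‖ ^ 2 := by
  simp only [Complex.inner, Complex.mul_re, Complex.mul_im, Complex.conj_re, Complex.conj_im, Complex.sq_norm,
    Complex.normSq_apply]
  ring

/-- **FLAT UNIQUENESS FOR THE EXACT EULER ROW.** If `w` is differentiable on `(−δ′, δ′)` with `R·w′ = ν w` there and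
`Re ν < 0`, then `w = 0` on `(−δ′, δ′)`: `w(0) = 0` from the equation at `R = 0`, and `‖w‖²` is non-increasing on
`[0, δ′)`, non-decreasing on `(−δ′, 0]`. [folklore] -/
theorem eq_zero_of_euler_row {ν : ℂ} {w : ℝ → ℂ} {δ' : ℝ} (hν : ν.re < 0)
    (hw : ∀ R ∈ Ioo (-δ') δ', DifferentiableAt ℝ w R)
    (hode : ∀ R ∈ Ioo (-δ') δ', (R : ℂ) * deriv w R = ν * w R) : ∀ R ∈ Ioo (-δ') δ', w R = 0 := by
  have hν0 : ν ≠ 0 := fun h => by rw [h, Complex.zero_re] at hν; exact lt_irrefl _ hν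
  intro R₀ hR₀
  have hδ' : 0 < δ' := by linarith [hR₀.1, hR₀.2]
  have h0 : (0 : ℝ) ∈ Ioo (-δ') δ' := ⟨by linarith, hδ'⟩
  have hw0 : w 0 = 0 := by
    have := hode 0 h0
    simp only [Complex.ofReal_zero, zero_mul] at this
    exact (mul_eq_zero.1 this.symm).resolve_left hν0
  -- the energy `φ = ‖w‖²` and its derivative
  set φ : ℝ → ℝ := fun R => ‖w R‖ ^ 2 with hφ
  have hφd : ∀ R ∈ Ioo (-δ') δ', HasDerivAt φ (2 * ⟪w R, deriv w R⟫) R := fun R hR => (hw R hR).hasDerivAt.norm_sq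
  have hφR : ∀ R ∈ Ioo (-δ') δ', R * deriv φ R = 2 * ν.re * ‖w R‖ ^ 2 := by
    intro R hR
    rw [(hφd R hR).deriv]
    have h1 : (R : ℝ) * ⟪w R, deriv w R⟫ = ⟪w R, (R : ℂ) * deriv w R⟫ := by
      rw [← Complex.real_smul, real_inner_smul_right]
    calc R * (2 * ⟪w R, deriv w R⟫) = 2 * (R * ⟪w R, deriv w R⟫) := by ring
      _ = 2 * ν.re * ‖w R‖ ^ 2 := by rw [h1, hode R hR, real_inner_mul_self_left]; ring
  have hφc : ContinuousOn φ (Ioo (-δ') δ') := fun R hR =>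
    ((hw R hR).continuousAt.norm.pow 2).continuousWithinAt
  have hφ0 : φ 0 = 0 := by simp [hφ, hw0]
  have hφdiff : ∀ {s : Set ℝ}, s ⊆ Ioo (-δ') δ' → DifferentiableOn ℝ φ s := fun hs R hR =>
    (hφd R (hs hR)).differentiableAt.differentiableWithinAt
  -- monotonicity on each side
  have hle : φ R₀ ≤ φ 0 := by
    rcases le_or_gt 0 R₀ with h | h
    · have hsub : Icc 0 R₀ ⊆ Ioo (-δ') δ' := fun y hy => ⟨by linarith [hy.1], lt_of_le_of_lt hy.2 hR₀.2⟩
      have hanti := antitoneOn_of_deriv_nonpos (convex_Icc 0 R₀) (hφc.mono hsub)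
        (by rw [interior_Icc]; exact hφdiff (Ioo_subset_Icc_self.trans hsub)) (fun x hx => by
          rw [interior_Icc] at hx
          have hxU := hsub (Ioo_subset_Icc_self hx)
          have key := hφR x hxU
          have hx0 : 0 < x := hx.1
          have : deriv φ x = 2 * ν.re * ‖w x‖ ^ 2 / x := by rw [eq_div_iff hx0.ne', mul_comm]; exact key
          rw [this]
          exact div_nonpos_of_nonpos_of_nonneg (by nlinarith [sq_nonneg ‖w x‖]) hx0.le)
      exact hanti (left_mem_Icc.2 h) (right_mem_Icc.2 h) h
    · have hsub : Icc R₀ 0 ⊆ Ioo (-δ') δ' := fun y hy => ⟨lt_of_lt_of_le hR₀.1 hy.1, by linarith [hy.2]⟩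
      have hmono := monotoneOn_of_deriv_nonneg (convex_Icc R₀ 0) (hφc.mono hsub)
        (by rw [interior_Icc]; exact hφdiff (Ioo_subset_Icc_self.trans hsub)) (fun x hx => by
          rw [interior_Icc] at hx
          have hxU := hsub (Ioo_subset_Icc_self hx)
          have key := hφR x hxU
          have hx0 : x < 0 := hx.2
          have : deriv φ x = 2 * ν.re * ‖w x‖ ^ 2 / x := by rw [eq_div_iff hx0.ne, mul_comm]; exact key
          rw [this]
          exact div_nonneg_of_nonpos (by nlinarith [sq_nonneg ‖w x‖]) hx0.le)
      exact hmono (left_mem_Icc.2 h.le) (right_mem_Icc.2 h.le) h.le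
  rw [hφ0] at hle
  have : ‖w R₀‖ ^ 2 = 0 := le_antisymm hle (sq_nonneg _)
  exact norm_eq_zero.1 (pow_eq_zero_iff two_ne_zero |>.1 this)

/-! ## The uniform smooth branch -/

/-- **Registered helper `res_fuchs_uniform`: THE SMOOTH BRANCH FOR `Re ν ≤ −1` WITH UNIFORM RADIUS, A PRIORI BOUNDS
AND UNIQUENESS.** See the module docstring. [folklore] -/
theorem res_fuchs_uniform : ∀ (E : Type) [NormedAddCommGroup E] [NormedSpace ℂ E] [CompleteSpace E] (A₁ A B D : ℝ), 0 ≤ A₁ → 0 ≤ A → 0 ≤ B → 0 ≤ D → ∃ δ : ℝ, 0 < δ ∧ δ ≤ 1 ∧ ∃ K : ℝ, 0 ≤ K ∧ ∀ (ν : ℂ) (a₁₁ : ℝ → ℂ) (a₁₂ : ℝ → E →L[ℂ] ℂ) (a₂₁ : ℝ → ℂ →L[ℂ] E) (a₂₂ : ℝ → E →L[ℂ] E), ν.re ≤ -1 → ContDiff ℝ ∞ a₁₁ → ContDiff ℝ ∞ a₁₂ → ContDiff ℝ ∞ a₂₁ → ContDiff ℝ ∞ a₂₂ → a₁₁ 0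 = ν → (∀ s ∈ Set.Icc (-1 : ℝ) 1, ‖deriv a₁₁ s‖ ≤ A₁ ∧ ‖a₁₂ s‖ ≤ A ∧ ‖a₂₁ s‖ ≤ B ∧ ‖a₂₂ s‖ ≤ D) → ∀ (b₁ : ℝ → ℂ) (b₂ : ℝ → E), ContDiff ℝ ∞ b₁ → ContDiff ℝ ∞ b₂ → (∀ c₀ : E, ∃ (u : ℝ → ℂ) (c : ℝ → E), ContDiffOn ℝ ∞ u (Set.Ioo (-δ) δ) ∧ ContDiffOn ℝ ∞ c (Set.Ioo (-δ) δ) ∧ c 0 = c₀ ∧ ∀ R ∈ Set.Ioo (-δ) δ, (R : ℂ) * deriv u R = a₁₁ R * u R + a₁₂ R (c R) + b₁ R ∧ deriv c R = a₂₁ R (u R) + a₂₂ R (c R) + b₂ R) ∧ (∀ (u : ℝ → ℂ) (c : ℝ → E) (δ' : ℝ), 0 < δ' → δ' ≤ δ → ContDiffOn ℝ 1 u (Set.Ioo (-δ') δ') → ContDiffOn ℝ 1 c (Set.Ioo (-δ') δ') → (∀ R ∈ Set.Ioo (-δ') δ', (R : ℂ) * deriv u R = a₁₁ R * u R + a₁₂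 R (c R) + b₁ R ∧ deriv c R = a₂₁ R (u R) + a₂₂ R (c R) + b₂ R) → ∀ (R₁ N : ℝ), 0 ≤ R₁ → R₁ < δ' → (∀ s ∈ Set.Icc (-R₁) R₁, ‖b₁ s‖ ≤ N ∧ ‖b₂ s‖ ≤ N) → ∀ R ∈ Set.Icc (-R₁) R₁, ‖u R‖ ≤ K * (‖c 0‖ + N) ∧ ‖c R‖ ≤ K * (‖c 0‖ + N)) := by
  intro E _ _ _ A₁ A B D hA₁ hA hB hD
  obtain ⟨δ, hδ, hδ1, K, hK, hV⟩ := res_volterra_uniform E (Real.exp A₁) (Real.exp (-A₁)) A B D (Real.exp_pos _)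
    (Real.exp_pos _).le hA hB hD
  refine ⟨δ, hδ, hδ1, K, hK, fun ν a₁₁ a₁₂ a₂₁ a₂₂ hν ha₁₁ ha₁₂ ha₂₁ ha₂₂ h0 hbd b₁ b₂ hb₁ hb₂ => ?_⟩
  set a : ℂ := -ν - 1 with ha_def
  have ha : 0 ≤ a.re := by simp only [ha_def, Complex.sub_re, Complex.neg_re, Complex.one_re]; linarith
  have hν0 : ν ≠ 0 := fun h => by rw [h, Complex.zero_re] at hν; linarith
  -- Hadamard `a₁₁ − ν = R·α` with `‖α‖ ≤ A₁` on `[−1, 1]`, integrating factor `μ`, `e^{−A₁} ≤ ‖μ‖ ≤ e^{A₁}`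
  obtain ⟨α, hα, hαeq, hα0⟩ := hadamard_quotient (φ := fun R => a₁₁ R - ν) (ha₁₁.sub contDiff_const) (by simp [h0])
  have hαb : ∀ s ∈ Icc (-1 : ℝ) 1, ‖α s‖ ≤ A₁ := by
    intro s hs
    rcases eq_or_ne s 0 with rfl | hs0
    · rw [hα0, deriv_sub_const]; exact (hbd 0 (by norm_num)).1
    · have hmvt := Convex.norm_image_sub_le_of_norm_deriv_le (f := a₁₁) (C := A₁) (s := Icc (-1 : ℝ) 1)
        (fun x _ => ha₁₁.differentiable (by simp) x) (fun x hx => (hbd x hx).1) (convex_Icc _ _)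
        (show (0 : ℝ) ∈ Icc (-1 : ℝ) 1 from ⟨by norm_num, by norm_num⟩) hs
      rw [sub_zero, h0, Real.norm_eq_abs] at hmvt
      have e : a₁₁ s - ν = s * α s := hαeq s
      rw [e, norm_mul, Complex.norm_real, Real.norm_eq_abs] at hmvt
      exact le_of_mul_le_mul_left (by linarith [hmvt]) (abs_pos.2 hs0)
  obtain ⟨hPsm, hPd⟩ := contDiff_primitive hα
  set μ : ℝ → ℂ := fun R => Complex.exp (∫ s in (0 : ℝ)..R, α s) with hμ
  have hμsm : ContDiff ℝ ∞ μ := Complex.contDiff_exp.comp hPsm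
  have hμ0 : ∀ R, μ R ≠ 0 := fun R => Complex.exp_ne_zero _
  have hμd : ∀ R, HasDerivAt μ (α R * μ R) R := fun R => by
    have := (hPd R).cexp
    simpa [hμ, mul_comm] using this
  have hμb : ∀ s ∈ Icc (-1 : ℝ) 1, ‖μ s‖ ≤ Real.exp A₁ ∧ Real.exp (-A₁) ≤ ‖μ s‖ := by
    intro s hs
    have hI : ‖∫ t in (0 : ℝ)..s, α t‖ ≤ A₁ := by
      have hsub : ∀ t ∈ Ι (0 : ℝ) s, t ∈ Icc (-1 : ℝ) 1 := fun t ht => by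
        rcases le_or_gt 0 s with h | h
        · rw [uIoc_of_le h] at ht; exact ⟨by linarith [ht.1], ht.2.trans hs.2⟩
        · rw [uIoc_of_ge h.le] at ht; exact ⟨by linarith [ht.1, hs.1], by linarith [ht.2]⟩
      calc ‖∫ t in (0 : ℝ)..s, α t‖ ≤ A₁ * |s - 0| := norm_integral_le_of_norm_le_const fun t ht => hαb t (hsub t ht)
        _ ≤ A₁ * 1 := by rw [sub_zero]; exact mul_le_mul_of_nonneg_left (abs_le.2 ⟨hs.1, hs.2⟩) hA₁
        _ = A₁ := mul_one _
    have hre : |(∫ t in (0 : ℝ)..s, α t).re| ≤ A₁ := (Complex.abs_re_le_norm _).trans hI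
    simp only [hμ, Complex.norm_exp]
    exact ⟨Real.exp_le_exp.2 (abs_le.1 hre).2, Real.exp_le_exp.2 (abs_le.1 hre).1⟩
  have hbd' : ∀ s ∈ Icc (-1 : ℝ) 1, ‖μ s‖ ≤ Real.exp A₁ ∧ Real.exp (-A₁) ≤ ‖μ s‖ ∧ ‖a₁₂ s‖ ≤ A ∧ ‖a₂₁ s‖ ≤ B ∧
      ‖a₂₂ s‖ ≤ D := fun s hs => ⟨(hμb s hs).1, (hμb s hs).2, (hbd s hs).2.1, (hbd s hs).2.2.1, (hbd s hs).2.2.2⟩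
  have hVμ := hV a μ a₁₂ a₂₁ a₂₂ ha hμsm.continuous hμ0 ha₁₂.continuous ha₂₁.continuous ha₂₂.continuous hbd' b₁ b₂
    hb₁.continuous hb₂.continuous
  have hle : ∀ {n : ℕ∞}, ((n : ℕ∞) : WithTop ℕ∞) ≤ ∞ := fun {n} => by exact_mod_cast le_top
  constructor
  · -- EXISTENCE: the Volterra solution is smooth and solves (verbatim `res_fuchs_branch`)
    intro c₀
    obtain ⟨⟨u, c, hu_cont, hc_cont, hu, hc⟩, -⟩ := hVμ c₀
    have hU : IsOpen (Ioo (-δ) δ) := isOpen_Ioo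
    set h : ℝ → ℂ := fun s => (a₁₂ s (c s) + b₁ s) / μ s with hh
    set Y : ℝ → ℂ := fun R => ∫ t in (0 : ℝ)..1, (t : ℂ) ^ a * h (R * t) with hY
    set Kf : ℝ → E := fun s => a₂₁ s (u s) + a₂₂ s (c s) + b₂ s with hKf
    have huY : u = fun R => μ R * Y R := funext fun R => by rw [hu R]
    have hKc : Continuous Kf :=
      ((ha₂₁.continuous.clm_apply hu_cont).add (ha₂₂.continuous.clm_apply hc_cont)).add hb₂.continuous
    have hcd : ∀ R ∈ Ioo (-δ) δ, HasDerivAt c (Kf R) R := by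
      intro R hR
      have hprim : HasDerivAt (fun R => c₀ + ∫ s in (0 : ℝ)..R, Kf s) (Kf R) R := by
        have := integral_hasDerivAt_right (hKc.intervalIntegrable 0 R) hKc.aestronglyMeasurable.stronglyMeasurableAtFilter
          hKc.continuousAt
        simpa using this.const_add c₀
      refine hprim.congr_of_eventuallyEq ?_
      filter_upwards [hU.mem_nhds hR] with s hs
      rw [hc s (Ioo_subset_Icc_self hs)]
    have hhdef : h = fun s => (μ s)⁻¹ * (a₁₂ s (c s) + b₁ s) := funext fun s => by rw [hh]; simp only; rw [div_eq_inv_mul]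
    have hboot : ∀ k : ℕ, ContDiffOn ℝ k c (Ioo (-δ) δ) ∧ ContDiffOn ℝ k u (Ioo (-δ) δ) := by
      have step_u : ∀ {n : ℕ∞}, ContDiffOn ℝ n c (Ioo (-δ) δ) → ContDiffOn ℝ n u (Ioo (-δ) δ) := by
        intro n hcn
        have hhn : ContDiffOn ℝ n h (Ioo (-δ) δ) := by
          rw [hhdef]
          exact ((hμsm.of_le hle).contDiffOn.inv fun s _ => hμ0 s).mul
            ((contDiffOn_clm_apply_real (ha₁₂.of_le hle).contDiffOn hcn).add (hb₁.of_le hle).contDiffOn)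
        rw [huY]
        exact (hμsm.of_le hle).contDiffOn.mul (contDiffOn_eulerCpow_local ha hhn)
      intro k
      induction k with
      | zero =>
        have hc0 : ContDiffOn ℝ 0 c (Ioo (-δ) δ) := contDiffOn_zero.2 hc_cont.continuousOn
        exact ⟨by exact_mod_cast hc0, by exact_mod_cast step_u hc0⟩
      | succ k ih =>
        obtain ⟨ihc, ihu⟩ := ih
        have hKk : ContDiffOn ℝ k Kf (Ioo (-δ) δ) :=
          ((contDiffOn_clm_apply_real (ha₂₁.of_le hle).contDiffOn ihu).add
            (contDiffOn_clm_apply_real (ha₂₂.of_le hle).contDiffOn ihc)).add (hb₂.of_le hle).contDiffOn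
        have hck : ContDiffOn ℝ ((k + 1 : ℕ) : WithTop ℕ∞) c (Ioo (-δ) δ) := by
          rw [Nat.cast_succ, contDiffOn_succ_iff_deriv_of_isOpen hU]
          refine ⟨fun R hR => (hcd R hR).differentiableAt.differentiableWithinAt,
            fun h => (WithTop.natCast_ne_top k h).elim, ?_⟩
          exact hKk.congr fun R hR => (hcd R hR).deriv
        have hck' : ContDiffOn ℝ ((k + 1 : ℕ) : ℕ∞) c (Ioo (-δ) δ) := by exact_mod_cast hck
        exact ⟨by exact_mod_cast hck', by exact_mod_cast step_u hck'⟩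
    have hcs : ContDiffOn ℝ ∞ c (Ioo (-δ) δ) := contDiffOn_infty.2 fun k => (hboot k).1
    have hus : ContDiffOn ℝ ∞ u (Ioo (-δ) δ) := contDiffOn_infty.2 fun k => (hboot k).2
    have hhs : ContDiffOn ℝ ∞ h (Ioo (-δ) δ) := by
      rw [hhdef]
      exact (hμsm.contDiffOn.inv fun s _ => hμ0 s).mul
        ((contDiffOn_clm_apply_real ha₁₂.contDiffOn hcs).add hb₁.contDiffOn)
    obtain ⟨hYs, hYode, -⟩ := eulerCpow_local a δ h ha hδ hhs
    refine ⟨u, c, hus, hcs, by have := hc 0 ⟨by linarith, by linarith⟩; simpa using this, fun R hR => ⟨?_, (hcd R hR).deriv⟩⟩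
    have hYd : HasDerivAt Y (deriv Y R) R :=
      ((hYs.differentiableOn (by simp)) R hR).differentiableAt (hU.mem_nhds hR) |>.hasDerivAt
    have hud : HasDerivAt u (α R * μ R * Y R + μ R * deriv Y R) R := by
      rw [huY]; exact (hμd R).mul hYd
    rw [hud.deriv]
    have e1' : (R : ℂ) * deriv Y R = ν * Y R + h R := by
      have : -(a + 1) = ν := by rw [ha_def]; ring
      rw [← this]; exact hYode R hR
    have e2 : (R : ℂ) * α R = a₁₁ R - ν := by simpa using (hαeq R).symm
    have e3 : μ R * h R = a₁₂ R (c R) + b₁ R := by simp only [hh]; field_simp [hμ0 R]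
    have e4 : u R = μ R * Y R := by rw [huY]
    rw [e4]
    linear_combination (μ R * Y R) * e2 + μ R * e1' + e3
  · -- THE A PRIORI BOUND: a `C¹` solution satisfies the Volterra integral equations
    intro u c δ' hδ' hδ'δ hu hc hode R₁ N hR₁ hR₁δ' hN
    have hU : IsOpen (Ioo (-δ') δ') := isOpen_Ioo
    have h0U : (0 : ℝ) ∈ Ioo (-δ') δ' := ⟨by linarith, hδ'⟩
    have hsubI : Icc (-R₁) R₁ ⊆ Ioo (-δ') δ' := fun s hs => ⟨by linarith [hs.1], lt_of_le_of_lt hs.2 hR₁δ'⟩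
    have hud : ∀ R ∈ Ioo (-δ') δ', HasDerivAt u (deriv u R) R := fun R hR =>
      ((hu.differentiableOn one_ne_zero) R hR |>.differentiableAt (hU.mem_nhds hR)).hasDerivAt
    have hcd : ∀ R ∈ Ioo (-δ') δ', HasDerivAt c (deriv c R) R := fun R hR =>
      ((hc.differentiableOn one_ne_zero) R hR |>.differentiableAt (hU.mem_nhds hR)).hasDerivAt
    -- the `c`-row in integral form (fundamental theorem of calculus)
    set Kf : ℝ → E := fun s => a₂₁ s (u s) + a₂₂ s (c s) + b₂ s with hKf
    have hKfc : ContinuousOn Kf (Ioo (-δ') δ') :=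
      ((ha₂₁.continuous.continuousOn.clm_apply hu.continuousOn).add
        (ha₂₂.continuous.continuousOn.clm_apply hc.continuousOn)).add hb₂.continuous.continuousOn
    have hcI : ∀ R ∈ Icc (-R₁) R₁, c R = c 0 + ∫ s in (0 : ℝ)..R, (a₂₁ s (u s) + a₂₂ s (c s) + b₂ s) := by
      intro R hR
      have hsub : uIcc 0 R ⊆ Ioo (-δ') δ' := fun y hy => by
        rcases mem_uIcc.1 hy with h | h
        · exact ⟨by linarith [h.1], lt_of_le_of_lt (h.2.trans hR.2) hR₁δ'⟩
        · exact ⟨by linarith [h.1, hR.1], by linarith [h.2]⟩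
      have hFTC := intervalIntegral.integral_eq_sub_of_hasDerivAt (f := c) (f' := Kf)
        (fun y hy => by have := hcd y (hsub hy); rwa [(hode y (hsub hy)).2] at this)
        ((hKfc.mono hsub).intervalIntegrable)
      rw [hFTC]; abel
    -- the `u`-row in integral form: `w = u/μ − E_a h` solves the exact Euler row, so `w = 0`
    set h : ℝ → ℂ := fun s => (a₁₂ s (c s) + b₁ s) / μ s with hh
    have hh1 : ContDiffOn ℝ 1 h (Ioo (-δ') δ') := by
      have e : h = fun s => (μ s)⁻¹ * (a₁₂ s (c s) + b₁ s) := funext fun s => by rw [hh]; simp only; rw [div_eq_inv_mul]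
      rw [e]
      exact ((hμsm.of_le hle).contDiffOn.inv fun s _ => hμ0 s).mul
        ((contDiffOn_clm_apply_real (ha₁₂.of_le hle).contDiffOn hc).add (hb₁.of_le hle).contDiffOn)
    set Y : ℝ → ℂ := fun R => ∫ t in (0 : ℝ)..1, (t : ℂ) ^ a * h (R * t) with hY
    have hY1 : ContDiffOn ℝ 1 Y (Ioo (-δ') δ') := contDiffOn_eulerCpow_local ha hh1
    have hYd : ∀ R ∈ Ioo (-δ') δ', HasDerivAt Y (deriv Y R) R := fun R hR =>
      ((hY1.differentiableOn one_ne_zero) R hR |>.differentiableAt (hU.mem_nhds hR)).hasDerivAt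
    have hYode : ∀ R ∈ Ioo (-δ') δ', (R : ℂ) * deriv Y R = ν * Y R + h R := by
      intro R₀ hR₀
      obtain ⟨r, h1, -, g, hg, hgh, hev⟩ := eulerCpow_loc a hh1 hR₀
      have hR₀r : R₀ ∈ Icc (-r) r := ⟨by linarith [(abs_lt.1 h1).1], by linarith [(abs_lt.1 h1).2]⟩
      have hν' : -(a + 1) = ν := by rw [ha_def]; ring
      have d1 : deriv Y R₀ = deriv (fun R => ∫ t in (0 : ℝ)..1, (t : ℂ) ^ a * g (R * t)) R₀ := hev.deriv_eq
      have d2 : Y R₀ = ∫ t in (0 : ℝ)..1, (t : ℂ) ^ a * g (R₀ * t) := hev.eq_of_nhds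
      rw [d1, d2, ← hgh hR₀r, ← hν']
      exact eulerCpow_identity ha hg R₀
    set w : ℝ → ℂ := fun R => u R / μ R - Y R with hw
    have hwd : ∀ R ∈ Ioo (-δ') δ', HasDerivAt w ((deriv u R * μ R - u R * (α R * μ R)) / μ R ^ 2 - deriv Y R) R :=
      fun R hR => ((hud R hR).div (hμd R) (hμ0 R)).sub (hYd R hR)
    have hwode : ∀ R ∈ Ioo (-δ') δ', (R : ℂ) * deriv w R = ν * w R := by
      intro R hR
      rw [(hwd R hR).deriv]
      have e1 := (hode R hR).1
      have e2 : (R : ℂ) * α R = a₁₁ R - ν := by simpa using (hαeq R).symm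
      have e3 := hYode R hR
      have e4 : h R * μ R = a₁₂ R (c R) + b₁ R := by simp only [hh]; field_simp [hμ0 R]
      have hi : μ R * (μ R)⁻¹ = 1 := mul_inv_cancel₀ (hμ0 R)
      have ediv : ∀ z : ℂ, z / μ R ^ 2 = z * (μ R)⁻¹ ^ 2 := fun z => by rw [div_eq_mul_inv, inv_pow]
      simp only [hw, ediv, div_eq_mul_inv]
      linear_combination (μ R * (μ R)⁻¹ ^ 2) * e1 - (u R * μ R * (μ R)⁻¹ ^ 2) * e2 - e3 - (μ R * (μ R)⁻¹ ^ 2) * e4 +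
        (h R * (μ R * (μ R)⁻¹ + 1) + ν * u R * (μ R)⁻¹) * hi
    have hwz := eq_zero_of_euler_row (by linarith) (fun R hR => (hwd R hR).differentiableAt) hwode
    have huI : ∀ R ∈ Icc (-R₁) R₁, u R = μ R * ∫ t in (0 : ℝ)..1, (t : ℂ) ^ a *
        ((a₁₂ (R * t) (c (R * t)) + b₁ (R * t)) / μ (R * t)) := by
      intro R hR
      have := hwz R (hsubI hR)
      simp only [hw, sub_eq_zero] at this
      show u R = μ R * Y R
      rw [← this]
      field_simp [hμ0 R]
    exact (hVμ (c 0)).2 u c R₁ N hR₁ (by linarith) (hu.continuousOn.mono hsubI) (hc.continuousOn.mono hsubI) huI hcI hN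


/-! ## The scalar form, with evenness -/

/-- **Registered helper `fuchs_branch_uniform`: THE SCALAR SMOOTH BRANCH FOR `Re ν ≤ −1` WITH UNIFORM RADIUS, A PRIORI
BOUNDS, UNIQUENESS AND EVENNESS.** For bounds `A₁, A, B, D` there are `0 < δ ≤ 1`, `K ≥ 0` such that for the scalar
system `R u′ = a₁₁ u + a₁₂ c + b₁`, `c′ = a₂₁ u + a₂₂ c + b₂` with `a₁₁(0) = ν`, `Re ν ≤ −1`, `‖a₁₁′‖ ≤ A₁`, `‖a₁₂‖ ≤ A`,
`‖a₂₁‖ ≤ B`, `‖a₂₂‖ ≤ D` on `[−1, 1]`: smooth solutions with prescribed `c(0)` exist on `(−δ, δ)`; every `C¹` solution on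
`(−δ′, δ′) ⊆ (−δ, δ)` is bounded by `K(‖c(0)‖ + N)` on `[−R₁, R₁]`, `R₁ < δ′`, if the sources are bounded by `N` there;
and every `C¹` solution is even if `a₁₁, a₁₂, b₁` are even and `a₂₁, a₂₂, b₂` odd. [folklore] -/
theorem fuchs_branch_uniform : ∀ (A₁ A B D : ℝ), 0 ≤ A₁ → 0 ≤ A → 0 ≤ B → 0 ≤ D → ∃ δ : ℝ, 0 < δ ∧ δ ≤ 1 ∧ ∃ K : ℝ, 0 ≤ K ∧ ∀ (ν : ℂ) (a₁₁ a₁₂ a₂₁ a₂₂ : ℝ → ℂ), ν.re ≤ -1 → ContDiff ℝ ∞ a₁₁ → ContDiff ℝ ∞ a₁₂ → ContDiff ℝ ∞ a₂₁ → ContDiff ℝ ∞ a₂₂ → a₁₁ 0 = ν → (∀ s ∈ Set.Icc (-1 : ℝ) 1, ‖deriv a₁₁ s‖ ≤ A₁ ∧ ‖a₁₂ s‖ ≤ A ∧ ‖a₂₁ s‖ ≤ B ∧ ‖a₂₂ s‖ ≤ D) → ∀ (b₁ b₂ : ℝ → ℂ), ContDiff ℝ ∞ b₁ → ContDiff ℝ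 ∞ b₂ → (∀ c₀ : ℂ, ∃ u c : ℝ → ℂ, ContDiffOn ℝ ∞ u (Set.Ioo (-δ) δ) ∧ ContDiffOn ℝ ∞ c (Set.Ioo (-δ) δ) ∧ c 0 = c₀ ∧ ∀ R ∈ Set.Ioo (-δ) δ, (R : ℂ) * deriv u R = a₁₁ R * u R + a₁₂ R * c R + b₁ R ∧ deriv c R = a₂₁ R * u R + a₂₂ R * c R + b₂ R) ∧ (∀ (u c : ℝ → ℂ) (δ' : ℝ), 0 < δ' → δ' ≤ δ → ContDiffOn ℝ 1 u (Set.Ioo (-δ') δ') → ContDiffOn ℝ 1 c (Set.Ioo (-δ') δ') → (∀ R ∈ Set.Ioo (-δ') δ', (R : ℂ) * deriv u R = a₁₁ R * u R + a₁₂ R * c R + b₁ R ∧ deriv c R = a₂₁ R * u R + a₂₂ R * c R + b₂ R) → ∀ (R₁ N : ℝ), 0 ≤ R₁ → R₁ < δ' → (∀ s ∈ Set.Icc (-R₁) R₁, ‖b₁ s‖ ≤ N ∧ ‖b₂ s‖ ≤ N) → ∀ R ∈ Set.Icc (-R₁) R₁, ‖u R‖ ≤ K * (‖c 0‖ + N)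 ∧ ‖c R‖ ≤ K * (‖c 0‖ + N)) ∧ ((∀ R, a₁₁ (-R) = a₁₁ R) → (∀ R, a₁₂ (-R) = a₁₂ R) → (∀ R, b₁ (-R) = b₁ R) → (∀ R, a₂₁ (-R) = -a₂₁ R) → (∀ R, a₂₂ (-R) = -a₂₂ R) → (∀ R, b₂ (-R) = -b₂ R) → ∀ (u c : ℝ → ℂ) (δ' : ℝ), 0 < δ' → δ' ≤ δ → ContDiffOn ℝ 1 u (Set.Ioo (-δ') δ') → ContDiffOn ℝ 1 c (Set.Ioo (-δ') δ') → (∀ R ∈ Set.Ioo (-δ') δ', (R : ℂ) * deriv u R = a₁₁ R * u R + a₁₂ R * c R + b₁ R ∧ deriv c R = a₂₁ R * u R + a₂₂ R * c R + b₂ R) → ∀ R ∈ Set.Ioo (-δ') δ', u (-R) = u R ∧ c (-R) = c R) := by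
  intro A₁ A B D hA₁ hA hB hD
  obtain ⟨δ, hδ, hδ1, K, hK, hmain⟩ := res_fuchs_uniform ℂ A₁ A B D hA₁ hA hB hD
  refine ⟨δ, hδ, hδ1, K, hK, fun ν a₁₁ a₁₂ a₂₁ a₂₂ hν ha₁₁ ha₁₂ ha₂₁ ha₂₂ h0 hbd b₁ b₂ hb₁ hb₂ => ?_⟩
  have hsm : ∀ {a : ℝ → ℂ}, ContDiff ℝ ∞ a → ContDiff ℝ ∞ (fun R => a R • ContinuousLinearMap.id ℂ ℂ) :=
    fun ha => ha.smul contDiff_const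
  have hnsm : ∀ (z : ℂ), ‖z • ContinuousLinearMap.id ℂ ℂ‖ ≤ ‖z‖ := fun z => by
    rw [norm_smul]; exact mul_le_of_le_one_right (norm_nonneg _) ContinuousLinearMap.norm_id_le
  have hbd' : ∀ s ∈ Icc (-1 : ℝ) 1, ‖deriv a₁₁ s‖ ≤ A₁ ∧ ‖a₁₂ s • ContinuousLinearMap.id ℂ ℂ‖ ≤ A ∧
      ‖a₂₁ s • ContinuousLinearMap.id ℂ ℂ‖ ≤ B ∧ ‖a₂₂ s • ContinuousLinearMap.id ℂ ℂ‖ ≤ D := fun s hs =>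
    ⟨(hbd s hs).1, (hnsm _).trans (hbd s hs).2.1, (hnsm _).trans (hbd s hs).2.2.1, (hnsm _).trans (hbd s hs).2.2.2⟩
  have hinst := fun (β₁ β₂ : ℝ → ℂ) (hβ₁ : ContDiff ℝ ∞ β₁) (hβ₂ : ContDiff ℝ ∞ β₂) => hmain ν a₁₁
    (fun R => a₁₂ R • ContinuousLinearMap.id ℂ ℂ) (fun R => a₂₁ R • ContinuousLinearMap.id ℂ ℂ)
    (fun R => a₂₂ R • ContinuousLinearMap.id ℂ ℂ) hν ha₁₁ (hsm ha₁₂) (hsm ha₂₁) (hsm ha₂₂) h0 hbd' β₁ β₂ hβ₁ hβ₂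
  obtain ⟨hex, hap⟩ := hinst b₁ b₂ hb₁ hb₂
  obtain ⟨-, hap0⟩ := hinst (fun _ => 0) (fun _ => 0) contDiff_const contDiff_const
  simp only [FunLike.coe_smul, Pi.smul_apply, ContinuousLinearMap.id_apply, smul_eq_mul] at hex hap hap0
  refine ⟨hex, fun u c δ' hδ' hδ'δ hu hc hode => hap u c δ' hδ' hδ'δ hu hc hode,
    fun e₁₁ e₁₂ eb₁ o₂₁ o₂₂ ob₂ u c δ' hδ' hδ'δ hu hc hode R hR => ?_⟩
  -- EVENNESS: the anti-symmetric part solves the system with zero sources and zero datum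
  have hU : IsOpen (Ioo (-δ') δ') := isOpen_Ioo
  have hnegU : ∀ {x : ℝ}, x ∈ Ioo (-δ') δ' → -x ∈ Ioo (-δ') δ' := fun hx => ⟨by linarith [hx.2], by linarith [hx.1]⟩
  have hd : ∀ {φ : ℝ → ℂ}, ContDiffOn ℝ 1 φ (Ioo (-δ') δ') → ∀ x ∈ Ioo (-δ') δ', HasDerivAt φ (deriv φ x) x :=
    fun hφ x hx => ((hφ.differentiableOn one_ne_zero) x hx |>.differentiableAt (hU.mem_nhds hx)).hasDerivAt
  have hdn : ∀ {φ : ℝ → ℂ}, ContDiffOn ℝ 1 φ (Ioo (-δ') δ') → ∀ x ∈ Ioo (-δ') δ',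
      HasDerivAt (fun y => φ (-y)) (-deriv φ (-x)) x := fun hφ x hx => by
    have h := (hd hφ (-x) (hnegU hx)).scomp x (hasDerivAt_neg x)
    simpa [Function.comp_def] using h
  have hrefl : ∀ {φ : ℝ → ℂ}, ContDiffOn ℝ 1 φ (Ioo (-δ') δ') → ContDiffOn ℝ 1 (fun y => φ (-y)) (Ioo (-δ') δ') :=
    fun hφ => hφ.comp contDiff_neg.contDiffOn fun x hx => hnegU hx
  set du : ℝ → ℂ := fun y => u y - u (-y) with hdu
  set dc : ℝ → ℂ := fun y => c y - c (-y) with hdc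
  have hdu1 : ContDiffOn ℝ 1 du (Ioo (-δ') δ') := hu.sub (hrefl hu)
  have hdc1 : ContDiffOn ℝ 1 dc (Ioo (-δ') δ') := hc.sub (hrefl hc)
  have hode' : ∀ x ∈ Ioo (-δ') δ', (x : ℂ) * deriv du x = a₁₁ x * du x + a₁₂ x * dc x + (fun _ => (0 : ℂ)) x ∧
      deriv dc x = a₂₁ x * du x + a₂₂ x * dc x + (fun _ => (0 : ℂ)) x := by
    intro x hx
    obtain ⟨e1, e2⟩ := hode x hx
    obtain ⟨f1, f2⟩ := hode (-x) (hnegU hx)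
    rw [e₁₁, e₁₂, eb₁] at f1
    rw [o₂₁, o₂₂, ob₂] at f2
    have d1 : deriv du x = deriv u x - -deriv u (-x) := ((hd hu x hx).sub (hdn hu x hx)).deriv
    have d2 : deriv dc x = deriv c x - -deriv c (-x) := ((hd hc x hx).sub (hdn hc x hx)).deriv
    rw [d1, d2]
    simp only [hdu, hdc]
    push_cast at f1 ⊢
    exact ⟨by linear_combination e1 - f1, by linear_combination e2 + f2⟩
  have hR₁ : |R| < δ' := abs_lt.2 hR
  have key := hap0 du dc δ' hδ' hδ'δ hdu1 hdc1 hode' |R| 0 (abs_nonneg R) hR₁ (fun s _ => by simp) R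
    ⟨neg_abs_le R, le_abs_self R⟩
  have hdc0 : dc 0 = 0 := by simp [hdc]
  rw [hdc0, norm_zero, zero_add, mul_zero] at key
  obtain ⟨k1, k2⟩ := key
  have e1 : du R = 0 := norm_eq_zero.1 (le_antisymm k1 (norm_nonneg _))
  have e2 : dc R = 0 := norm_eq_zero.1 (le_antisymm k2 (norm_nonneg _))
  simp only [hdu, hdc, sub_eq_zero] at e1 e2
  exact ⟨e1.symm, e2.symm⟩

end Summit.AtomisticToContinuum.HydrodynamicLimit.Theorems.SonicCavityRenewal

end
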